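import Summits.BirchSwinnertonDyer.Rank1Residual.Ordinary.CyclicSylowClassExponent
import Summits.BirchSwinnertonDyer.Rank1Residual.Ordinary.LocalPointsModPrimePower
import HarnessLib

/-!
# The two local exponents of the reciprocity skeleton in the `ord_p` currency: under ANY identification
# `G/p^n·G ≅ ℤ/p^n`, the class of `c·P̄` in `Ẽ(𝔽_ℓ)/p^n` has `ord_p = min(n, v_p(c) + v_ℓ(P))` and the
# class of `P` in `E(ℚ_p)/p^n` has `ord_p = min(n, m_p(P))` (theorems only; no definition, no named fact,
# nothing asserted about any curve's BSD; C-16 stays a CONJECTURE)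

HONEST FRAMING (cell `b2b-bsdres`, run/shared/lean/b2b/bsd-rank1-residual/, verbatim in every
file): the goal of the cell is to DELETE the COMBINATION-SHAPED residual classes of the
Birch–Swinnerton-Dyer formula for ALL analytic-rank `≤ 1` elliptic curves over `ℚ` — "full BSD
formula for every rank `≤ 1` curve in class `C`" assembled STRICTLY from published theorems — so
that the rank-`≤ 1` remainder becomes exactly the CONSTRUCTION-SHAPED classes, which are TYPED
(missing-input `Prop`s), NOT attempted. This is not "finishing BSD". Seat `b2b-bsdres-additive-p3`
(X8 prover B / X7 joint; typer-designate for the cell conjecture C-16 = hyp C120.1 by hyp R-16 (e)).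
This file books nothing and moves no mark; X7 / X8 stay CONSTRUCTION-SHAPED.

## What this file does

The reciprocity skeleton (`Ordinary/DepthLawReciprocitySkeleton.lean`, additive-p3 GEN 36) takes as
HYPOTHESES, for elements of `ℤ/p^n`, the two local divisibility exponents of `R1-DEPTH-LAW.md` §2 (ii)–(iii):
`ord_p yl = min(n, v)` and `ord_p xl = min(n, a + v)` for the classes of `P̄` and `p^a·u·P̄` in
`H¹_f(ℚ_ℓ, W) = Ẽ(𝔽_ℓ)/p^n ≅ ℤ/p^n`, and `ord_p yp = min(n, m)` for the class of `P` in
`H¹_f(ℚ_p, W) = E(ℚ_p)/p^n ≅ ℤ/p^n`. The siblings prove the divisibility profiles behind them INSIDE the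
groups: `Ordinary/CyclicSylowClassExponent.lean` (`(∃ Q̄, p^k Q̄ = c P̄) ⟺ p^{k − v_ℓ(P)} ∣ c`, `k ≤ e_ℓ`,
cyclic `p`-Sylow) and `Ordinary/LocalPointsModPrimePower.lean` (`(∃ Q, p^k Q = c P) ⟺ p^{k − m} ∣ c` at a
good non-anomalous odd `p`, `#Ẽ(𝔽_p)·P` of formal level exactly `m + 1`, `m ≤ k`). This file is the
one-paragraph bridge: for ANY surjective additive map `φ : G → ℤ/p^n` with kernel `p^n·G` (i.e. any choice of
the identification `G/p^n G ≅ ℤ/p^n`, whose existence is the rank-one freeness of the local condition, a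
hypothesis here as in the skeleton), a divisibility profile `(∃ y, p^k y = c x) ⟺ p^{k − e} ∣ c` (`k ≤ n`)
gives **`ord_p φ(c·x) = min(n, v_p(c) + e)`** (§1, `zmodPowOrd_map_smul_eq`; the typed `zmodPowOrd` of
`KuriharaExactOrderVocabulary`); §2 specialises to the reduction `Ẽ(𝔽_ℓ)` (`e = localDivExponent W p ℓ P`,
the skeleton's `hxl` / `hyl` shapes) and §3 to `E(ℚ_p)` (`e = m_p`, the skeleton's `hyp` shape; the profile
below `m` is supplied here from the level-`m` instance). So of the skeleton's hypotheses exactly the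
COHOMOLOGICAL ones remain hypotheses (Kato's class and `a = m_p + FLOOR`, the Kolyvagin-system transport at
`ℓ`, perfectness of the two local pairings, reciprocity, Kim Thm. 3.13): the two local exponents are theorems.

References: J. H. Silverman, AEC 2nd ed. (2009), VII.2.1, IV.2.3, IV.6.4 (b) (through the siblings)
[SilvermanAEC2009]; `R1-DEPTH-LAW.md` §2 (ii)–(iii); hyp `SHARPENED-CONJECTURES.md` §120.
-/

noncomputable section

open scoped Classical

open WeierstrassCurve Literature.NumberTheory.EllipticCurves

namespace Summit.BirchSwinnertonDyer.Rank1Residual.Ordinary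

/-! ### §1 Abstract: `ord_p` of a class under any identification `G/p^n G ≅ ℤ/p^n` -/

section Abstract

variable {G : Type*} [AddCommGroup G] {p : ℕ}

/-- Under a surjective additive map `φ : G → ℤ/p^n` with kernel exactly `p^n·G`, divisibility of `φ x` by
`p^m` (`m ≤ n`) in `ℤ/p^n` is divisibility of `x` by `p^m` in `G`. [folklore] -/
theorem natCast_pow_dvd_map_iff (hp : p.Prime) {n : ℕ} (φ : G →+ ZMod (p ^ n))
    (hφ : Function.Surjective φ) (hker : ∀ g : G, φ g = 0 ↔ ∃ h : G, p ^ n • h = g)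
    {m : ℕ} (hm : m ≤ n) (x : G) :
    ((p ^ m : ℕ) : ZMod (p ^ n)) ∣ φ x ↔ ∃ y : G, p ^ m • y = x := by
  have _ := hp
  constructor
  · rintro ⟨z, hz⟩
    obtain ⟨y, rfl⟩ := hφ z
    have h0 : φ (x - p ^ m • y) = 0 := by
      rw [map_sub, map_nsmul, hz, nsmul_eq_mul, sub_self]
    obtain ⟨h, hh⟩ := (hker _).mp h0
    refine ⟨y + p ^ (n - m) • h, ?_⟩
    rw [smul_add, smul_smul, pow_mul_pow_sub p hm, hh, add_sub_cancel]
  · rintro ⟨y, rfl⟩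
    exact ⟨φ y, by rw [map_nsmul, nsmul_eq_mul]⟩

/-- **`ord_p` of the class of `c·x` is `min(n, v_p(c) + e)`** when `x` has the divisibility profile
`(∃ y, p^k·y = c′·x) ⟺ p^{k − e} ∣ c′` for all `k ≤ n` (`e` = the divisibility exponent of `x`), under ANY
surjective `φ : G → ℤ/p^n` with kernel `p^n·G`; `c ≠ 0`. For `c = p^a·u` with `p ∤ u` this is the printed
«`p^a·u·x̄` has order-exponent `min(n, a + e)`» of `R1-DEPTH-LAW.md` §2 (ii). [folklore] -/
theorem zmodPowOrd_map_smul_eq (hp : p.Prime) {n : ℕ} (φ : G →+ ZMod (p ^ n))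
    (hφ : Function.Surjective φ) (hker : ∀ g : G, φ g = 0 ↔ ∃ h : G, p ^ n • h = g) {x : G} {e : ℕ}
    (hprof : ∀ k ≤ n, ∀ c : ℕ, (∃ y : G, p ^ k • y = c • x) ↔ p ^ (k - e) ∣ c) {c : ℕ} (hc : c ≠ 0) :
    zmodPowOrd p n (φ (c • x)) = min n (padicValNat p c + e) := by
  haveI : Fact p.Prime := ⟨hp⟩
  have key : ∀ m ≤ n, (m ≤ zmodPowOrd p n (φ (c • x)) ↔ m ≤ padicValNat p c + e) := by
    intro m hm
    rw [le_zmodPowOrd_iff_natCast_pow_dvd hp hm, natCast_pow_dvd_map_iff hp φ hφ hker hm, hprof m hm c,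
      padicValNat_dvd_iff_le hc]
    omega
  apply le_antisymm
  · have h1 := zmodPowOrd_le hp (φ (c • x))
    exact le_min h1 ((key _ h1).mp le_rfl)
  · rcases le_total n (padicValNat p c + e) with h | h
    · rw [min_eq_left h]
      exact (key n le_rfl).mpr h
    · rw [min_eq_right h]
      exact (key _ h).mpr le_rfl

/-- `c = 1`: **`ord_p φ(x) = min(n, e)`**. [folklore] -/
theorem zmodPowOrd_map_eq (hp : p.Prime) {n : ℕ} (φ : G →+ ZMod (p ^ n))
    (hφ : Function.Surjective φ) (hker : ∀ g : G, φ g = 0 ↔ ∃ h : G, p ^ n • h = g) {x : G} {e : ℕ}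
    (hprof : ∀ k ≤ n, ∀ c : ℕ, (∃ y : G, p ^ k • y = c • x) ↔ p ^ (k - e) ∣ c) :
    zmodPowOrd p n (φ x) = min n e := by
  haveI : Fact p.Prime := ⟨hp⟩
  have h := zmodPowOrd_map_smul_eq hp φ hφ hker hprof one_ne_zero
  rwa [one_smul, padicValNat_one_right, zero_add] at h

/-- `c = p^a·u`, `p ∤ u`: **`ord_p φ(p^a·u·x) = min(n, a + e)`** — the skeleton's `hxl` shape with
`a = m_p + FLOOR`. [folklore] -/
theorem zmodPowOrd_map_pow_mul_smul_eq (hp : p.Prime) {n : ℕ} (φ : G →+ ZMod (p ^ n))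
    (hφ : Function.Surjective φ) (hker : ∀ g : G, φ g = 0 ↔ ∃ h : G, p ^ n • h = g) {x : G} {e : ℕ}
    (hprof : ∀ k ≤ n, ∀ c : ℕ, (∃ y : G, p ^ k • y = c • x) ↔ p ^ (k - e) ∣ c) (a : ℕ) {u : ℕ}
    (hu : ¬ p ∣ u) :
    zmodPowOrd p n (φ ((p ^ a * u) • x)) = min n (a + e) := by
  haveI : Fact p.Prime := ⟨hp⟩
  have hu0 : u ≠ 0 := fun h => hu (h ▸ dvd_zero p)
  have hc : p ^ a * u ≠ 0 := mul_ne_zero (pow_ne_zero a hp.ne_zero) hu0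
  rw [zmodPowOrd_map_smul_eq hp φ hφ hker hprof hc, padicValNat.mul (pow_ne_zero a hp.ne_zero) hu0,
    padicValNat.prime_pow, padicValNat.eq_zero_of_not_dvd hu, add_zero]

end Abstract

/-! ### §2 At a good prime `ℓ ≠ p` with cyclic `p`-torsion: the classes of `P̄` and `c·P̄` in `Ẽ(𝔽_ℓ)/p^n` -/

section Reduction

variable (W : WeierstrassCurve ℚ) [W.IsElliptic] [W.IsGloballyMinimal] (p ℓ : ℕ) [Fact p.Prime]
  [Fact ℓ.Prime]

/-- **`ord_p` of the class of `c·P̄` in `Ẽ(𝔽_ℓ)/p^n ≅ ℤ/p^n` is `min(n, v_p(c) + v_ℓ(P))`** (`c ≠ 0`), at a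
good prime `ℓ ≠ p` with `#Ẽ(𝔽_ℓ)[p] ≤ p` and `n ≤ e_ℓ = v_p #Ẽ(𝔽_ℓ)` (a cyclic depth-`n` level), under ANY
surjective additive `φ : Ẽ(𝔽_ℓ) → ℤ/p^n` with kernel `p^n·Ẽ(𝔽_ℓ)`; `v_ℓ(P) = localDivExponent W p ℓ P`, `P̄` read
on the residue field of `ℤ_ℓ` as in the vocabulary file. With `c = p^a·u` (`a = m_p + FLOOR`) this is the
skeleton's hypothesis `hxl`. [cite: SilvermanAEC2009, Prop. VII.2.1 and Prop. IV.2.3] -/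
theorem zmodPowOrd_map_smul_reduction_eq (hgood : ¬ (ℓ : ℤ) ∣ minimalDiscriminantInt W) (hℓp : ℓ ≠ p)
    (hcyc : Nat.card {c : (((integralModelInt W).map (Int.castRingHom ℤ_[ℓ])).map
      (IsLocalRing.residue ℤ_[ℓ])).toAffine.Point // p • c = 0} ≤ p)
    {n : ℕ} (hn : n ≤ padicValNat p (W.reductionPointCount ℓ))
    (φ : (((integralModelInt W).map (Int.castRingHom ℤ_[ℓ])).map
      (IsLocalRing.residue ℤ_[ℓ])).toAffine.Point →+ ZMod (p ^ n))
    (hφ : Function.Surjective φ) (hker : ∀ g, φ g = 0 ↔ ∃ h, p ^ n • h = g)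
    (P : W.toAffine.Point) {c : ℕ} (hc : c ≠ 0) :
    zmodPowOrd p n (φ (c • reducePoint ((integralModelInt W).map (Int.castRingHom ℤ_[ℓ]))
        (Affine.Point.congrEquiv (W.padicModel_baseChange ℓ).symm
          (Affine.Point.map (W' := W.toAffine) (Algebra.ofId ℚ ℚ_[ℓ]) P)))) =
      min n (padicValNat p c + localDivExponent W p ℓ P) :=
  zmodPowOrd_map_smul_eq (Fact.out) φ hφ hker
    (fun _ hk c' => exists_pow_smul_eq_smul_reduction_iff_pow_sub_localDivExponent_dvd W p ℓ hgood hℓp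
      hcyc P (hk.trans hn) c') hc

/-- **`ord_p` of the class of `P̄` in `Ẽ(𝔽_ℓ)/p^n` is `min(n, v_ℓ(P))`** — the skeleton's hypothesis `hyl`.
[cite: SilvermanAEC2009, Prop. VII.2.1 and Prop. IV.2.3] -/
theorem zmodPowOrd_map_reduction_eq (hgood : ¬ (ℓ : ℤ) ∣ minimalDiscriminantInt W) (hℓp : ℓ ≠ p)
    (hcyc : Nat.card {c : (((integralModelInt W).map (Int.castRingHom ℤ_[ℓ])).map
      (IsLocalRing.residue ℤ_[ℓ])).toAffine.Point // p • c = 0} ≤ p)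
    {n : ℕ} (hn : n ≤ padicValNat p (W.reductionPointCount ℓ))
    (φ : (((integralModelInt W).map (Int.castRingHom ℤ_[ℓ])).map
      (IsLocalRing.residue ℤ_[ℓ])).toAffine.Point →+ ZMod (p ^ n))
    (hφ : Function.Surjective φ) (hker : ∀ g, φ g = 0 ↔ ∃ h, p ^ n • h = g)
    (P : W.toAffine.Point) :
    zmodPowOrd p n (φ (reducePoint ((integralModelInt W).map (Int.castRingHom ℤ_[ℓ]))
        (Affine.Point.congrEquiv (W.padicModel_baseChange ℓ).symm
          (Affine.Point.map (W' := W.toAffine) (Algebra.ofId ℚ ℚ_[ℓ]) P)))) =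
      min n (localDivExponent W p ℓ P) :=
  zmodPowOrd_map_eq (Fact.out) φ hφ hker
    (fun _ hk c' => exists_pow_smul_eq_smul_reduction_iff_pow_sub_localDivExponent_dvd W p ℓ hgood hℓp
      hcyc P (hk.trans hn) c')

/-- `c = p^a·u`, `p ∤ u`: **`ord_p` of the class of `p^a·u·P̄` is `min(n, a + v_ℓ(P))`** — literally the
skeleton's `hxl` (`a = m_p + FLOOR`, `u` the unit of Mazur–Rubin 5.2.12).
[cite: SilvermanAEC2009, Prop. VII.2.1 and Prop. IV.2.3] -/
theorem zmodPowOrd_map_pow_mul_smul_reduction_eq (hgood : ¬ (ℓ : ℤ) ∣ minimalDiscriminantInt W)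
    (hℓp : ℓ ≠ p)
    (hcyc : Nat.card {c : (((integralModelInt W).map (Int.castRingHom ℤ_[ℓ])).map
      (IsLocalRing.residue ℤ_[ℓ])).toAffine.Point // p • c = 0} ≤ p)
    {n : ℕ} (hn : n ≤ padicValNat p (W.reductionPointCount ℓ))
    (φ : (((integralModelInt W).map (Int.castRingHom ℤ_[ℓ])).map
      (IsLocalRing.residue ℤ_[ℓ])).toAffine.Point →+ ZMod (p ^ n))
    (hφ : Function.Surjective φ) (hker : ∀ g, φ g = 0 ↔ ∃ h, p ^ n • h = g)
    (P : W.toAffine.Point) (a : ℕ) {u : ℕ} (hu : ¬ p ∣ u) :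
    zmodPowOrd p n (φ ((p ^ a * u) • reducePoint ((integralModelInt W).map (Int.castRingHom ℤ_[ℓ]))
        (Affine.Point.congrEquiv (W.padicModel_baseChange ℓ).symm
          (Affine.Point.map (W' := W.toAffine) (Algebra.ofId ℚ ℚ_[ℓ]) P)))) =
      min n (a + localDivExponent W p ℓ P) :=
  zmodPowOrd_map_pow_mul_smul_eq (Fact.out) φ hφ hker
    (fun _ hk c' => exists_pow_smul_eq_smul_reduction_iff_pow_sub_localDivExponent_dvd W p ℓ hgood hℓp
      hcyc P (hk.trans hn) c') a hu

end Reduction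

/-! ### §3 At a good non-anomalous odd `p`: the class of `P` in `E(ℚ_p)/p^n` -/

section Padic

variable (W : WeierstrassCurve ℚ) [W.IsElliptic] [W.IsGloballyMinimal] (p : ℕ) [Fact p.Prime]

/-- The full divisibility profile of `P ∈ E(ℚ_p)` with `#Ẽ(𝔽_p)·P` of formal level exactly `m + 1` (so
`m = m_p(P)`): **`(∃ Q, p^k·Q = c·P) ⟺ p^{k − m} ∣ c` for EVERY `k` and `c ∈ ℕ`** (the sibling states it for
`m ≤ k`, `c ∈ ℤ`; below `m` both sides hold, from the `k = m` instance). [cite: SilvermanAEC2009, IV.6.4 (b)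
and VII.2.1] -/
theorem exists_pow_smul_eq_nsmul_iff_pow_sub_dvd (hp2 : p ≠ 2)
    (hgood : ¬ (p : ℤ) ∣ minimalDiscriminantInt W) (hna : ¬ p ∣ W.reductionPointCount p)
    {P : (W.baseChange ℚ_[p]).toAffine.Point} {m : ℕ}
    (hm1 : W.reductionPointCount p • P ∈ (W.baseChange ℚ_[p]).formalFiltration (m + 1))
    (hm2 : W.reductionPointCount p • P ∉ (W.baseChange ℚ_[p]).formalFiltration (m + 2))
    (k : ℕ) (c : ℕ) :
    (∃ Q : (W.baseChange ℚ_[p]).toAffine.Point, p ^ k • Q = c • P) ↔ p ^ (k - m) ∣ c := by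
  rcases le_or_gt m k with hmk | hkm
  · have h := exists_pow_smul_eq_zsmul_iff_pow_sub_dvd W p hp2 hgood hna hm1 hm2 hmk (c : ℤ)
    rw [natCast_zsmul, ← Nat.cast_pow, Int.natCast_dvd_natCast] at h
    exact h
  · obtain ⟨Q, hQ⟩ :=
      (exists_pow_smul_eq_zsmul_iff_pow_sub_dvd W p hp2 hgood hna hm1 hm2 le_rfl (c : ℤ)).mpr
        (by rw [Nat.sub_self, pow_zero]; exact one_dvd _)
    rw [natCast_zsmul] at hQ
    rw [show k - m = 0 by omega, pow_zero]
    exact iff_of_true ⟨p ^ (m - k) • Q, by rw [smul_smul, ← pow_add, Nat.add_sub_cancel' hkm.le, hQ]⟩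
      (one_dvd _)

/-- **`ord_p` of the class of `P` in `E(ℚ_p)/p^n ≅ ℤ/p^n` is `min(n, m_p(P))`** at a good non-anomalous odd
`p`, `#Ẽ(𝔽_p)·P` of formal level exactly `m + 1`, under ANY surjective additive `φ : E(ℚ_p) → ℤ/p^n` with
kernel `p^n·E(ℚ_p)` — the skeleton's hypothesis `hyp` (`m = 0` on C-16's letter: the class of `P` GENERATES).
[cite: SilvermanAEC2009, IV.6.4 (b) and VII.2.1] -/
theorem zmodPowOrd_map_point_eq (hp2 : p ≠ 2)
    (hgood : ¬ (p : ℤ) ∣ minimalDiscriminantInt W) (hna : ¬ p ∣ W.reductionPointCount p)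
    {P : (W.baseChange ℚ_[p]).toAffine.Point} {m : ℕ}
    (hm1 : W.reductionPointCount p • P ∈ (W.baseChange ℚ_[p]).formalFiltration (m + 1))
    (hm2 : W.reductionPointCount p • P ∉ (W.baseChange ℚ_[p]).formalFiltration (m + 2))
    {n : ℕ} (φ : (W.baseChange ℚ_[p]).toAffine.Point →+ ZMod (p ^ n)) (hφ : Function.Surjective φ)
    (hker : ∀ g, φ g = 0 ↔ ∃ h, p ^ n • h = g) :
    zmodPowOrd p n (φ P) = min n m :=
  zmodPowOrd_map_eq (Fact.out) φ hφ hker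
    (fun k _ c => exists_pow_smul_eq_nsmul_iff_pow_sub_dvd W p hp2 hgood hna hm1 hm2 k c)

/-- Same, for the class of `c·P` (`c ≠ 0`): `ord_p = min(n, v_p(c) + m_p(P))`. [cite: SilvermanAEC2009,
IV.6.4 (b) and VII.2.1] -/
theorem zmodPowOrd_map_smul_point_eq (hp2 : p ≠ 2)
    (hgood : ¬ (p : ℤ) ∣ minimalDiscriminantInt W) (hna : ¬ p ∣ W.reductionPointCount p)
    {P : (W.baseChange ℚ_[p]).toAffine.Point} {m : ℕ}
    (hm1 : W.reductionPointCount p • P ∈ (W.baseChange ℚ_[p]).formalFiltration (m + 1))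
    (hm2 : W.reductionPointCount p • P ∉ (W.baseChange ℚ_[p]).formalFiltration (m + 2))
    {n : ℕ} (φ : (W.baseChange ℚ_[p]).toAffine.Point →+ ZMod (p ^ n)) (hφ : Function.Surjective φ)
    (hker : ∀ g, φ g = 0 ↔ ∃ h, p ^ n • h = g) {c : ℕ} (hc : c ≠ 0) :
    zmodPowOrd p n (φ (c • P)) = min n (padicValNat p c + m) :=
  zmodPowOrd_map_smul_eq (Fact.out) φ hφ hker
    (fun k _ c' => exists_pow_smul_eq_nsmul_iff_pow_sub_dvd W p hp2 hgood hna hm1 hm2 k c') hc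

end Padic

end Summit.BirchSwinnertonDyer.Rank1Residual.Ordinary

end
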